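/-
Literature reproduction (pub-hodgecm model-construction cell, mc-unitary-2 lineage gen 6).

# Deep principal congruence subgroups of a unitary group lie in `SU`

For the unitary group `U(J)` of a non-degenerate form `J` (`det J ≠ 0`) attached to an extension `E/F` of
number fields with an automorphism `c` fixing every infinite place of `E` (the CM situation: `E` CM,
`F = E⁺`, `c` = complex conjugation), every element `γ` of the principal congruence subgroup `Γ(n)`,
`n ≥ 3`, has `det γ = 1`.  Proof (folklore; the ingredients are Kronecker 1857 and Minkowski 1887):
`d = det γ` is an algebraic integer with `d ≡ 1 (mod n)` because `γ ≡ 1 (mod n)` integrally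
(`IsCongruentOneMod.exists_det_eq_one_add_mul`, reduction of `det` modulo `n`); `c(d) · d = 1` from
`ᵗ(cγ) J γ = J` (`galConj_det_mul_det_eq_one`), and `|φ(c x)| = |φ x|` for every complex embedding `φ`
because `c` fixes the place of `φ` (`norm_embedding_galConj`), so every conjugate of `d` has absolute value
`1` (`norm_embedding_det_eq_one`); hence `d` is a root of unity (Kronecker, Mathlib
`NumberField.Embeddings.pow_eq_one_of_norm_eq_one`) congruent to `1 (mod n)`, `n ≥ 3`, hence `d = 1`
(Minkowski, tree `IsCongruentOneMod.eq_one_of_pow_eq_one` applied to the `1 × 1` matrix `(d)`):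
`eq_one_of_forall_norm_eq_one_of_eq_one_add_mul`.

Main statements: `det_eq_one_of_isCongruentOneMod` (`γ ∈ U(J)(F)`, `γ ≡ 1 (mod n)`, `n ≥ 3` ⟹ `det γ = 1`),
`det_eq_one_of_mem_principalCongruenceSubgroup`, `det_eq_one_of_mem_arithmeticLevel` (`γ ∈ Γ(K)` for a
finite level `K ≤ K_{U,f}(n𝓞_E)`, `n ≥ 3`), and the CM specialisations `…_cm`; `det_ne_zero_of_sylvesterFrame`
discharges `det H ≠ 0` from a Sylvester frame `ᵗT̄ (ιH) T = J_{2,1}`.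

These supply the hypothesis `det γ = 1` of `UnitaryGroup.exists_toAdelic_eq_adelicSingle_mul_mem_specialAwayLevel`
(`UnitaryGroupAwayLevel`) for deep principal levels.  (The `GL_n(ℤ)` analogue — `det γ = ±1 ≡ 1 (mod N)`,
`N ≥ 3` ⟹ `det γ = 1` — is the tree's `det_eq_one_of_mem_principalCongruenceSubgroupGLZ`, Getz–Hahn 2024,
Lemma 15.2.1; here the finiteness of `det` comes from Kronecker's theorem instead of `ℤˣ = {±1}`.)  Kernel lemmas only; no records, nothing is cited as a
hypothesis.  [cite: Minkowski1887, §1] (via the tree's `PrincipalCongruenceSubgroupTorsionFree`); Kronecker's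
theorem is Mathlib's.
-/
import Literature.Geometry.ComplexHyperbolic.UnitBallU21
import Literature.NumberTheory.Automorphic.UnitaryGroupArchimedean
import Literature.NumberTheory.Automorphic.UnitaryGroupArithmeticLevels
import HarnessLib

open NumberField NumberField.InfinitePlace
open scoped Matrix MatrixGroups ComplexConjugate

/-! ## 1. Scalar lemmas: `det` modulo `n`, Kronecker + Minkowski -/

namespace Literature.AlgebraicGeometry.ShimuraVarieties

variable {E : Type*} [Field E] [NumberField E] {m : Type*} [Fintype m] [DecidableEq m]

omit [NumberField E] in
/-- **`det (1 + nA) ≡ 1 (mod n)`**: the determinant of a matrix `≡ 1 (mod n)` integrally is an algebraic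
integer `≡ 1 (mod n)`: `det g = 1 + n·a` with `a ∈ 𝓞_E`. [folklore] -/
theorem IsCongruentOneMod.exists_det_eq_one_add_mul {n : ℕ} {g : Matrix m m E} (hg : IsCongruentOneMod n g) :
    ∃ a : 𝓞 E, g.det = 1 + n * algebraMap (𝓞 E) E a := by
  obtain ⟨A, rfl⟩ := hg
  set g₀ : Matrix m m (𝓞 E) := 1 + n • A with hg₀
  have hmap : (algebraMap (𝓞 E) E).mapMatrix g₀ = 1 + n • A.map (algebraMap (𝓞 E) E) := by
    rw [hg₀, map_add, map_one, map_nsmul, RingHom.mapMatrix_apply]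
  -- reduce `det g₀` modulo `n`
  set I : Ideal (𝓞 E) := Ideal.span {(n : 𝓞 E)} with hI
  have hπn : Ideal.Quotient.mk I (n : 𝓞 E) = 0 :=
    Ideal.Quotient.eq_zero_iff_mem.2 (Ideal.mem_span_singleton_self _)
  have hπg₀ : (Ideal.Quotient.mk I).mapMatrix g₀ = 1 := by
    rw [hg₀, map_add, map_one, map_nsmul, add_eq_left]
    ext i j
    rw [Matrix.smul_apply, RingHom.mapMatrix_apply, Matrix.map_apply, nsmul_eq_mul,
      ← map_natCast (Ideal.Quotient.mk I) n, hπn, zero_mul, Matrix.zero_apply]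
  have hdet : Ideal.Quotient.mk I (g₀.det - 1) = 0 := by
    rw [map_sub, map_one, RingHom.map_det, hπg₀, Matrix.det_one, sub_self]
  obtain ⟨a, ha⟩ := Ideal.mem_span_singleton'.1 (Ideal.Quotient.eq_zero_iff_mem.1 hdet)
  refine ⟨a, ?_⟩
  have hdet₀ : g₀.det = 1 + n * a := by linear_combination -ha
  rw [← hmap, ← RingHom.map_det, hdet₀, map_add, map_one, map_mul, map_natCast]

/-- **Kronecker + Minkowski (scalar case)**: an algebraic integer `x ≡ 1 (mod n)` (`x = 1 + n·a`, `a ∈ 𝓞_E`)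
of a number field, `n ≥ 3`, all of whose complex conjugates have absolute value `1`, equals `1` — by
Kronecker `x` is a root of unity (Mathlib `NumberField.Embeddings.pow_eq_one_of_norm_eq_one`), and a root of
unity `≡ 1 (mod n)`, `n ≥ 3`, is `1` (Minkowski; tree `IsCongruentOneMod.eq_one_of_pow_eq_one` for the
`1 × 1` matrix `(x)`). [cite: Minkowski1887, §1] -/
theorem eq_one_of_forall_norm_eq_one_of_eq_one_add_mul {n : ℕ} (hn : 3 ≤ n) {x : E} {a : 𝓞 E}
    (hx : x = 1 + n * algebraMap (𝓞 E) E a) (h1 : ∀ φ : E →+* ℂ, ‖φ x‖ = 1) : x = 1 := by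
  have hxi : IsIntegral ℤ x := by
    rw [hx, ← map_natCast (algebraMap (𝓞 E) E), ← map_mul, ← map_one (algebraMap (𝓞 E) E), ← map_add]
    exact RingOfIntegers.isIntegral_coe _
  obtain ⟨k, hk, hxk⟩ := NumberField.Embeddings.pow_eq_one_of_norm_eq_one E ℂ hxi h1
  have hcong : IsCongruentOneMod n (Matrix.scalar (Fin 1) x) := by
    refine ⟨Matrix.scalar (Fin 1) a, ?_⟩
    ext i j
    obtain rfl : i = j := Subsingleton.elim _ _
    rw [Matrix.add_apply, Matrix.smul_apply, Matrix.map_apply, Matrix.scalar_apply, Matrix.scalar_apply,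
      Matrix.diagonal_apply_eq, Matrix.diagonal_apply_eq, Matrix.one_apply_eq, hx, nsmul_eq_mul]
  have h := hcong.eq_one_of_pow_eq_one hn hk (by rw [← map_pow, hxk, map_one])
  simpa using congr_fun (congr_fun h 0) 0

end Literature.AlgebraicGeometry.ShimuraVarieties

/-! ## 2. `det γ = 1` on `Γ(n)`, `n ≥ 3`, for unitary groups -/

namespace Literature.NumberTheory.Automorphic.UnitaryGroup

open Literature.AlgebraicGeometry.ShimuraVarieties

variable (F E : Type) [Field F] [NumberField F] [Field E] [NumberField E] [Algebra F E]
  (c : E ≃ₐ[F] E) (N : ℕ) (J : Matrix (Fin N) (Fin N) E)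

omit [NumberField F] [NumberField E] in
/-- **`c(det γ) · det γ = 1`** for `γ ∈ U(J)(F)` with `det J ≠ 0` (take determinants in `ᵗ(cγ) J γ = J`).
[folklore] -/
theorem galConj_det_mul_det_eq_one (hJ : J.det ≠ 0) {γ : GL (Fin N) E} (hγ : γ ∈ rational F E c N J) :
    c (γ : Matrix (Fin N) (Fin N) E).det * (γ : Matrix (Fin N) (Fin N) E).det = 1 := by
  have h := congrArg Matrix.det (mem_unitaryGroupOfForm_iff.1 hγ)
  rw [Matrix.det_mul, Matrix.det_mul, Matrix.det_transpose, ← RingHom.mapMatrix_apply,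
    ← RingHom.map_det] at h
  have h' : ((c : E →+* E) (γ : Matrix (Fin N) (Fin N) E).det * (γ : Matrix (Fin N) (Fin N) E).det) * J.det =
      1 * J.det := by
    calc ((c : E →+* E) (γ : Matrix (Fin N) (Fin N) E).det * (γ : Matrix (Fin N) (Fin N) E).det) * J.det
        = (c : E →+* E) (γ : Matrix (Fin N) (Fin N) E).det * J.det * (γ : Matrix (Fin N) (Fin N) E).det := by
          ring
      _ = J.det := h
      _ = 1 * J.det := (one_mul _).symm
  exact mul_right_cancel₀ hJ h'

omit [NumberField F] [NumberField E] in
/-- **`|φ(c x)| = |φ(x)|`** for every complex embedding `φ` of `E` when `c` fixes every infinite place of `E`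
(`φ ∘ c` and `φ` define the same place). [folklore] -/
theorem norm_embedding_galConj (hfix : ∀ w : InfinitePlace E, c • w = w) (φ : E →+* ℂ) (x : E) :
    ‖φ (c x)‖ = ‖φ x‖ := by
  have h := congrArg (fun w : InfinitePlace E => w (c x)) (hfix (InfinitePlace.mk φ))
  simpa only [InfinitePlace.smul_apply, AlgEquiv.symm_apply_apply, InfinitePlace.apply] using h.symm

omit [NumberField F] [NumberField E] in
/-- **Every complex conjugate of `det γ`, `γ ∈ U(J)(F)`, has absolute value `1`** (`det J ≠ 0`, `c` fixing
the infinite places): `|φ(det γ)|² = |φ(c det γ)| · |φ(det γ)| = |φ(1)| = 1`. [folklore] -/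
theorem norm_embedding_det_eq_one (hfix : ∀ w : InfinitePlace E, c • w = w) (hJ : J.det ≠ 0)
    {γ : GL (Fin N) E} (hγ : γ ∈ rational F E c N J) (φ : E →+* ℂ) :
    ‖φ (γ : Matrix (Fin N) (Fin N) E).det‖ = 1 := by
  have h := congrArg (fun y => ‖φ y‖) (galConj_det_mul_det_eq_one F E c N J hJ hγ)
  simp only [map_mul, norm_mul, map_one, norm_one, norm_embedding_galConj F E c hfix] at h
  have h0 := norm_nonneg (φ (γ : Matrix (Fin N) (Fin N) E).det)
  rcases mul_self_eq_one_iff.1 h with h1 | h1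
  · exact h1
  · linarith

omit [NumberField F] in
/-- **`det γ = 1` for `γ ∈ U(J)(F)` with `γ ≡ 1 (mod n)` integrally, `n ≥ 3`** (`det J ≠ 0`, `c` fixing the
infinite places of `E`): `det γ` is an algebraic integer `≡ 1 (mod n)` all of whose conjugates have absolute
value `1`, hence `1` by Kronecker and Minkowski. [cite: Minkowski1887, §1] -/
theorem det_eq_one_of_isCongruentOneMod (hfix : ∀ w : InfinitePlace E, c • w = w) (hJ : J.det ≠ 0) {n : ℕ}
    (hn : 3 ≤ n) {γ : GL (Fin N) E} (hγ : γ ∈ rational F E c N J)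
    (hcong : IsCongruentOneMod n (γ : Matrix (Fin N) (Fin N) E)) : Matrix.GeneralLinearGroup.det γ = 1 := by
  obtain ⟨a, ha⟩ := hcong.exists_det_eq_one_add_mul
  have h1 := eq_one_of_forall_norm_eq_one_of_eq_one_add_mul hn ha
    (norm_embedding_det_eq_one F E c N J hfix hJ hγ)
  exact Units.ext (by simpa [Matrix.GeneralLinearGroup.val_det_apply] using h1)

omit [NumberField F] in
/-- **`Γ(n) ≤ SU` for `n ≥ 3`**: every element of the principal congruence subgroup
`Γ(n) = {γ ∈ U(J)(F) ∣ γ ≡ 1, γ⁻¹ ≡ 1 (mod n)}`, `n ≥ 3`, has determinant `1` (`det J ≠ 0`, `c` fixing the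
infinite places of `E`). [cite: Minkowski1887, §1] -/
theorem det_eq_one_of_mem_principalCongruenceSubgroup (hfix : ∀ w : InfinitePlace E, c • w = w)
    (hJ : J.det ≠ 0) {n : ℕ} (hn : 3 ≤ n) {γ : GL (Fin N) E}
    (hγ : γ ∈ principalCongruenceSubgroup (c : E →+* E) J n) : Matrix.GeneralLinearGroup.det γ = 1 := by
  obtain ⟨hu, hcong, -⟩ := hγ
  rw [unitaryGroup_eq_unitaryGroupOfForm] at hu
  exact det_eq_one_of_isCongruentOneMod F E c N J hfix hJ hn hu hcong

omit [NumberField F] in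
/-- **`det γ = 1` on the arithmetic level `Γ(K)` of any finite level `K ≤ K_{U,f}(n𝓞_E)`, `n ≥ 3`**
(`det J ≠ 0`, `c` fixing the infinite places of `E`); this is the hypothesis `det γ = 1` of
`exists_toAdelic_eq_adelicSingle_mul_mem_specialAwayLevel` for deep levels. [cite: Minkowski1887, §1] -/
theorem det_eq_one_of_mem_arithmeticLevel (hfix : ∀ w : InfinitePlace E, c • w = w) (hJ : J.det ≠ 0)
    {K : Subgroup (finAdelic F E c N J)} {n : ℕ} (hn : 3 ≤ n)
    (hKn : K ≤ finCongruenceLevel F E c N J (Ideal.span {(n : 𝓞 E)})) {γ : GL (Fin N) E}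
    (hγ : γ ∈ arithmeticLevel F E c N J K) : Matrix.GeneralLinearGroup.det γ = 1 :=
  det_eq_one_of_mem_principalCongruenceSubgroup F E c N J hfix hJ hn
    (((arithmeticLevel_mono hKn).trans (arithmeticLevel_finCongruenceLevel_span (by omega)).le) hγ)

/-! ## 3. CM specialisation (`E = L` a CM field, `F = L⁺`, `c` = complex conjugation) -/

section CM

open Literature.Geometry.ComplexHyperbolic

variable (L : Type) [Field L] [NumberField L] [IsCMField L] (H : Matrix (Fin N) (Fin N) L)

omit [NumberField L] [IsCMField L] in
/-- **A Sylvester frame forces `det H ≠ 0`**: if `ᵗT̄ · ι(H) · T = J_{2,1} = diag(1, 1, -1)` for some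
`T ∈ GL₃(ℂ)` and a complex embedding `ι`, then `det H ≠ 0` (`det J_{2,1} = -1`). [folklore] -/
theorem det_ne_zero_of_sylvesterFrame (ι : L →+* ℂ) (H : Matrix (Fin 3) (Fin 3) L) (T : GL (Fin 3) ℂ)
    (hT : (T : Matrix (Fin 3) (Fin 3) ℂ)ᴴ * H.map ι * (T : Matrix (Fin 3) (Fin 3) ℂ) = BallModel.J) :
    H.det ≠ 0 := by
  intro h0
  have h := congrArg Matrix.det hT
  rw [Matrix.det_mul, Matrix.det_mul, ← RingHom.mapMatrix_apply ι, ← RingHom.map_det, h0, map_zero,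
    mul_zero, zero_mul, BallModel.det_J] at h
  norm_num at h

/-- **CM form of `det_eq_one_of_isCongruentOneMod`**: for a CM field `L` and `γ ∈ U(H)(L⁺)` (the tree's
ball-quotient `unitaryGroup c̄ H`) with `γ ≡ 1 (mod n)` integrally, `n ≥ 3`, `det H ≠ 0`: `det γ = 1`.
[cite: Minkowski1887, §1] -/
theorem det_eq_one_of_isCongruentOneMod_cm (hH : H.det ≠ 0) {n : ℕ} (hn : 3 ≤ n) {γ : GL (Fin N) L}
    (hγ : γ ∈ Literature.AlgebraicGeometry.ShimuraVarieties.unitaryGroup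
      ((IsCMField.complexConj L : L ≃ₐ[↥(maximalRealSubfield L)] L) : L →+* L) H)
    (hcong : IsCongruentOneMod n (γ : Matrix (Fin N) (Fin N) L)) : Matrix.GeneralLinearGroup.det γ = 1 := by
  rw [unitaryGroup_eq_unitaryGroupOfForm] at hγ
  exact det_eq_one_of_isCongruentOneMod (↥(maximalRealSubfield L)) L (IsCMField.complexConj L) N H
    (complexConj_smul_infinitePlace L) hH hn hγ hcong

/-- **CM form of `det_eq_one_of_mem_principalCongruenceSubgroup`**: `Γ(n) ≤ SU(H)` for `n ≥ 3`
(`L` CM, `det H ≠ 0`). [cite: Minkowski1887, §1] -/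
theorem det_eq_one_of_mem_principalCongruenceSubgroup_cm (hH : H.det ≠ 0) {n : ℕ} (hn : 3 ≤ n)
    {γ : GL (Fin N) L}
    (hγ : γ ∈ principalCongruenceSubgroup
      ((IsCMField.complexConj L : L ≃ₐ[↥(maximalRealSubfield L)] L) : L →+* L) H n) :
    Matrix.GeneralLinearGroup.det γ = 1 :=
  det_eq_one_of_mem_principalCongruenceSubgroup (↥(maximalRealSubfield L)) L (IsCMField.complexConj L) N H
    (complexConj_smul_infinitePlace L) hH hn hγ

/-- **CM form of `det_eq_one_of_mem_arithmeticLevel`**: `det γ = 1` for `γ ∈ Γ(K)`, `K ≤ K_{U,f}(n𝓞_L)`,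
`n ≥ 3` (`L` CM, `det H ≠ 0`) — the hypothesis `hdet` of
`exists_archSectionU21CM_mul_mem_adelicUnitaryRat_of_mem_of_det_eq_one` at deep principal levels.
[cite: Minkowski1887, §1] -/
theorem det_eq_one_of_mem_arithmeticLevel_cm (hH : H.det ≠ 0)
    {K : Subgroup (finAdelic (↥(maximalRealSubfield L)) L (IsCMField.complexConj L) N H)} {n : ℕ}
    (hn : 3 ≤ n)
    (hKn : K ≤ finCongruenceLevel (↥(maximalRealSubfield L)) L (IsCMField.complexConj L) N H
      (Ideal.span {(n : 𝓞 L)}))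
    {γ : GL (Fin N) L}
    (hγ : γ ∈ arithmeticLevel (↥(maximalRealSubfield L)) L (IsCMField.complexConj L) N H K) :
    Matrix.GeneralLinearGroup.det γ = 1 :=
  det_eq_one_of_mem_arithmeticLevel (↥(maximalRealSubfield L)) L (IsCMField.complexConj L) N H
    (complexConj_smul_infinitePlace L) hH hn hKn hγ

end CM

end Literature.NumberTheory.Automorphic.UnitaryGroup
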